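import Summits.QuantumFields.YangMills.Theses.ToronSmallBall
import Summits.QuantumFields.YangMills.Theorems.QuantileBitPuritySectors
import HarnessLib

/-!
# Route `ToronSmallBall` (YangMills): the glue `OffCoreStripWindowDeepGlue` (item stmt-QuantumFields-24090) —
# `FluxSectorSuppression → PeriodicOffCoreStripWindowDeep → OffCoreStripWindowDeep`

Ruling (ii) of the critic of record of seat ym-idea-4 (2026-08-29T04:27Z) SPLIT the crux ⟨23957⟩ `OffCoreStripWindowDeep` (the deep
off-core swap-strip window: slice weight of `{|polDist U − polDist (swap₀₁ U)| ≤ β^{−γ}} ∩ {polDist U > β^{−γc}}` at most `β^{−a}·Z_phys(2L)`) into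
the electric-flux sector suppression ⟨24079⟩ `FluxSectorSuppression` (every seam-twisted sector `z ≠ 0` weighs `≤ β^{−a₁} Z_phys(2L)` on a window) and
its periodic-sector half ⟨24089⟩ `PeriodicOffCoreStripWindowDeep` (the same event weighs `≤ β^{−a} Z_phys(2L)` INSIDE the untwisted sector `z = 0`),
glued by THIS support item.  The proof is the eight-sector decomposition of the `2L`-ring weight landed by seat ym-dw-p1 g14
(`TT.ringInsTrace_indicator_zero_eq_sum_sectorWeight`, module `QuantileBitPuritySectors`):
`insTrace L β 𝟙_A 0 = ringInsTrace L β (2L−1) 𝟙_A 0 = (1/8) Σ_{z ∈ (ℤ/2)³} W_z(𝟙_A(U₀))`; the `z = 0` term is `≤ β^{−a} Z_phys(2L)` by the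
periodic half at the SAME exponent `a` (we take `a₀ := min(a₀', a₁)`), and each of the seven twisted terms is `≤ W_z(1) ≤ β^{−a₁} Z_phys(2L) ≤ β^{−a} Z_phys(2L)`
(`TT.sectorWeight_mono`, `a ≤ a₁`, `β ≥ 1`); the sum is `8 · β^{−a} Z_phys(2L)` and the factor `1/8` closes the bookkeeping.  The event is measurable
(`polDist` measurable, `configPerm` a measurable equivalence).

HONEST FRAMING: conditional glue between the route's own Props (width seat ym-line-sfw-p2-w3 g35, free hands); the cruxes ⟨24079⟩ and ⟨24089⟩ are
NOT proved; `ToronSmallBall` is a DRAFT-by-design line onto the RECORD rung K2 (`ThermalTraceWindow`); no summit statement is proved; the YM mass gap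
is NOT proved.  References: [cite: tHooft1979]; [cite: MontvayMunster1994, (3.145)]; [cite: Luscher1983, §2].
-/

set_option autoImplicit false

noncomputable section

open MeasureTheory Function
open scoped BigOperators
open Literature.MathematicalPhysics.QuantumFieldTheory hiding SU2
open Summit.QuantumFields.YangMills.Theorems

namespace Summit.QuantumFields.YangMills.Theorems.ToronSmallBall

open Summit.QuantumFields.YangMills.Theorems.FemtoTransferGap
open Summit.QuantumFields.YangMills.Theorems.FemtoTransferGap.FlatSheet
open Summit.QuantumFields.YangMills.Theorems.FemtoTransferGap.TT

/-- The deep off-core swap-strip event `{|polDist U − polDist (swap₀₁ U)| ≤ w} ∩ {x₀ < polDist U}` is measurable. [folklore] -/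
theorem measurableSet_stripOffCore (L : ℕ) [NeZero L] (w x₀ : ℝ) :
    MeasurableSet {U : GaugeConfig 3 L SU2 |
      |polDist U - polDist (configPerm (Equiv.swap (0 : Fin 3) 1) U)| ≤ w ∧ x₀ < polDist U} := by
  have h1 : Measurable fun U : GaugeConfig 3 L SU2 => |polDist U - polDist (configPerm (Equiv.swap (0 : Fin 3) 1) U)| :=
    (measurable_polDist.sub (measurable_polDist.comp (configPerm (Equiv.swap (0 : Fin 3) 1)).measurable)).abs
  rw [Set.setOf_and]
  exact (measurableSet_le h1 measurable_const).inter (measurableSet_lt measurable_const measurable_polDist)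

/-- ★ **The glue at the level of the three window statements** (all quantifiers explicit): electric-flux sector suppression with rate `β^{−a₁}` on
`L ≤ β^{a₁}` and the periodic-sector deep off-core strip window give the full deep off-core strip window, with `a₀ := min(a₀', a₁)` and the SAME
`γ` as the periodic half — by the eight-sector decomposition `insTrace 𝟙_A 0 = (1/8) Σ_z W_z(𝟙_A(U₀))`, the periodic bound on `z = 0` and
`W_z(𝟙_A) ≤ W_z(1) ≤ β^{−a₁} Z ≤ β^{−a} Z` on the seven twisted sectors. [cite: tHooft1979] [cite: MontvayMunster1994, (3.145)] -/
theorem offCoreStripWindowDeep_of_sectors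
    (hF : ∃ a : ℝ, 0 < a ∧ ∃ β₀ : ℝ, ∃ L₀ : ℕ, ∀ β : ℝ, β₀ ≤ β → ∀ (L : ℕ) [NeZero L], L₀ ≤ L → (L : ℝ) ≤ β ^ a →
      ∀ z : Fin 3 → Bool, z ≠ (fun _ => false) →
        sectorWeight (L := L) β (2 * L - 1) z (fun _ _ => (1 : ℝ)) ≤ β ^ (-a) * physTrace L β (2 * L))
    (hP : ∀ γc : ℝ, γc ≤ 2 / 5 → ∃ a₀ : ℝ, 0 < a₀ ∧ a₀ ≤ 1 ∧ ∀ a : ℝ, 0 < a → a ≤ a₀ → ∃ γ : ℝ, γ < 1 / 2 - 3 * a ∧ ∃ β₀ : ℝ, ∃ L₀ : ℕ,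
      ∀ β : ℝ, β₀ ≤ β → ∀ (L : ℕ) [NeZero L], L₀ ≤ L → (L : ℝ) ≤ β ^ a →
        sectorWeight (L := L) β (2 * L - 1) (fun _ => false)
          (fun Us _ => Set.indicator {U : GaugeConfig 3 L SU2 |
            |polDist U - polDist (configPerm (Equiv.swap (0 : Fin 3) 1) U)| ≤ β ^ (-γ) ∧ β ^ (-γc) < polDist U} (fun _ => (1 : ℝ)) (Us 0)) ≤
          β ^ (-a) * physTrace L β (2 * L)) :
    ∀ γc : ℝ, γc ≤ 2 / 5 → ∃ a₀ : ℝ, 0 < a₀ ∧ a₀ ≤ 1 ∧ ∀ a : ℝ, 0 < a → a ≤ a₀ → ∃ γ : ℝ, γ < 1 / 2 - 3 * a ∧ ∃ β₀ : ℝ, ∃ L₀ : ℕ,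
      ∀ β : ℝ, β₀ ≤ β → ∀ (L : ℕ) [NeZero L], L₀ ≤ L → (L : ℝ) ≤ β ^ a →
        insTrace L β (Set.indicator {U : GaugeConfig 3 L SU2 |
          |polDist U - polDist (configPerm (Equiv.swap (0 : Fin 3) 1) U)| ≤ β ^ (-γ) ∧ β ^ (-γc) < polDist U} fun _ => (1 : ℝ)) 0 ≤
          β ^ (-a) * physTrace L β (2 * L) := by
  intro γc hγc
  obtain ⟨a₁, ha₁, β₁, L₁, h1⟩ := hF
  obtain ⟨a₀', ha₀', ha₀'1, hP'⟩ := hP γc hγc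
  refine ⟨min a₀' a₁, lt_min ha₀' ha₁, (min_le_left _ _).trans ha₀'1, fun a ha haa₀ => ?_⟩
  obtain ⟨γ, hγ, β₂, L₂, h2⟩ := hP' a ha (haa₀.trans (min_le_left _ _))
  refine ⟨γ, hγ, max (max β₁ β₂) 1, max L₁ L₂, fun β hβ L _ hL hLβ => ?_⟩
  have hββ₁ : β₁ ≤ β := ((le_max_left _ _).trans (le_max_left _ _)).trans hβ
  have hββ₂ : β₂ ≤ β := ((le_max_right _ _).trans (le_max_left _ _)).trans hβ
  have hβ1 : 1 ≤ β := (le_max_right _ _).trans hβ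
  have hLL₁ : L₁ ≤ L := (le_max_left _ _).trans hL
  have hLL₂ : L₂ ≤ L := (le_max_right _ _).trans hL
  have haa₁ : a ≤ a₁ := haa₀.trans (min_le_right _ _)
  have hLa₁ : (L : ℝ) ≤ β ^ a₁ := hLβ.trans (Real.rpow_le_rpow_of_exponent_le hβ1 haa₁)
  -- the event and its measurability
  set A : Set (GaugeConfig 3 L SU2) := {U : GaugeConfig 3 L SU2 |
      |polDist U - polDist (configPerm (Equiv.swap (0 : Fin 3) 1) U)| ≤ β ^ (-γ) ∧ β ^ (-γc) < polDist U} with hA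
  have hAm : MeasurableSet A := measurableSet_stripOffCore L _ _
  -- `Z_phys(2L) ≥ 0` and `β^{-a₁} ≤ β^{-a}`
  set Z : ℝ := physTrace L β (2 * L) with hZ
  have hZdef : physTraceSucc L β (2 * L - 1) = Z := rfl
  have hZ0 : 0 ≤ Z := by
    have h := ringInsTrace_indicator_zero_nonneg (L := L) β (2 * L - 1) Set.univ
    rwa [Set.indicator_univ, ringInsTrace_const_one, hZdef] at h
  have hrate : β ^ (-a₁) ≤ β ^ (-a) := Real.rpow_le_rpow_of_exponent_le hβ1 (neg_le_neg haa₁)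
  -- every sector carries at most `β^{-a} Z` of the event
  have hsec : ∀ z : Fin 3 → Bool,
      sectorWeight (L := L) β (2 * L - 1) z (fun Us _ => A.indicator (fun _ => (1 : ℝ)) (Us 0)) ≤ β ^ (-a) * Z := by
    intro z
    by_cases hz : z = fun _ => false
    · rw [hz]; exact h2 β hββ₂ L hLL₂ hLβ
    · have hmono : sectorWeight (L := L) β (2 * L - 1) z (fun Us _ => A.indicator (fun _ => (1 : ℝ)) (Us 0)) ≤
          sectorWeight (L := L) β (2 * L - 1) z (fun _ _ => (1 : ℝ)) :=
        sectorWeight_mono β (2 * L - 1) z (measurable_uncurry_slice_zero (measurable_const.indicator hAm)) measurable_const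
          (C := 1) (fun Us _ => abs_indicator_one_le A (Us 0)) (fun _ _ => by rw [abs_one])
          (fun Us _ => Set.indicator_le_self' (fun _ _ => zero_le_one) (Us 0))
      calc sectorWeight (L := L) β (2 * L - 1) z (fun Us _ => A.indicator (fun _ => (1 : ℝ)) (Us 0))
          ≤ sectorWeight (L := L) β (2 * L - 1) z (fun _ _ => (1 : ℝ)) := hmono
        _ ≤ β ^ (-a₁) * Z := h1 β hββ₁ L hLL₁ hLa₁ z hz
        _ ≤ β ^ (-a) * Z := mul_le_mul_of_nonneg_right hrate hZ0
  -- the eight-sector decomposition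
  have hcard : (Finset.univ : Finset (Fin 3 → Bool)).card = 8 := by
    rw [Finset.card_univ, Fintype.card_fun, Fintype.card_bool, Fintype.card_fin]; norm_num
  rw [← ringInsTrace_two_mul_sub_one, ringInsTrace_indicator_zero_eq_sum_sectorWeight β (2 * L - 1) hAm]
  have hsum : ∑ z : Fin 3 → Bool, sectorWeight (L := L) β (2 * L - 1) z (fun Us _ => A.indicator (fun _ => (1 : ℝ)) (Us 0)) ≤
      8 * (β ^ (-a) * Z) := by
    have h := Finset.sum_le_card_nsmul (Finset.univ : Finset (Fin 3 → Bool))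
      (fun z => sectorWeight (L := L) β (2 * L - 1) z (fun Us _ => A.indicator (fun _ => (1 : ℝ)) (Us 0))) (β ^ (-a) * Z)
      (fun z _ => hsec z)
    rwa [hcard, nsmul_eq_mul, Nat.cast_ofNat] at h
  calc (1 / 8 : ℝ) * ∑ z : Fin 3 → Bool, sectorWeight (L := L) β (2 * L - 1) z (fun Us _ => A.indicator (fun _ => (1 : ℝ)) (Us 0))
      ≤ (1 / 8 : ℝ) * (8 * (β ^ (-a) * Z)) := mul_le_mul_of_nonneg_left hsum (by norm_num)
    _ = β ^ (-a) * Z := by ring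

/-- ★ **`OffCoreStripWindowDeepGlue` holds** (item stmt-QuantumFields-24090 of route `ToronSmallBall`, rev 4, BY NAME):
`FluxSectorSuppression → PeriodicOffCoreStripWindowDeep → OffCoreStripWindowDeep` — the instance of `offCoreStripWindowDeep_of_sectors`.  The two
hypotheses (cruxes ⟨24079⟩, ⟨24089⟩) are NOT proved; no summit statement is proved; the YM mass gap is NOT proved.
[cite: tHooft1979] [cite: MontvayMunster1994, (3.145)] -/
theorem toronSmallBall_offCoreStripWindowDeepGlue_proof :
    Summit.QuantumFields.YangMills.Theses.ToronSmallBall.OffCoreStripWindowDeepGlue := by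
  intro hF hP
  exact offCoreStripWindowDeep_of_sectors hF hP

end Summit.QuantumFields.YangMills.Theorems.ToronSmallBall

end
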